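import Mathlib
import Summits.Ventures.HodgeRepro.OcticCMPointInertModel
import Summits.Ventures.HodgeRepro.OcticCMPointTameSign
import Summits.Ventures.HodgeRepro.OcticCMPointConjDual

/-!
# OcticCMPointInertSign — `ε(½, ω, ψ_δ) = ±1` at the inert place `𝔮 | 2` at conductor `1`, on `𝔽₁₆`

Blind re-derivation cell `pub-hodge-repro`, seat night-2 (gen 4).  Target tree path
`lean/Summits/Ventures/HodgeRepro/OcticCMPointInertSign.lean`.  Composes `OcticCMPointInertModel.lean` (the
residue field `𝔽₁₆ = GaloisField 2 4`, the relative Frobenius `σ : x ↦ x⁴`, the primitive Frobenius-invariant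
`ψ̃ = ψ₀ ∘ Tr`) with gen 3's `OcticCMPointTameSign.lean` (`sign_q`: the tame sign on a field of `16` elements)
and `OcticCMPointConjDual.lean` (`conjDual_inert`).

* **`eps_sign_inert`** — for a tame conjugate-dual character `ω` at `𝔮 | 2` (`ω ∘ σ = ω⁻¹`, `ω(ϖ)² = 1` for
  the uniformiser `ϖ ∈ k_v` fixed by `σ`, `ω ≠ 1` on the units, `ω(ϖ) ≠ 0`) and the `s = ½` constant
  `κ² · 16 = 1`: `ε(½, ω, ψ̃) ∈ {1, −1}` — ROUTE-B §9.9 (f) at the inert place of the octic point at conductor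
  `1`, with the model hypotheses of gen 3 (`hR`, `hψ`, the conjugation) discharged.

**What this is not.**  Conductors `c ≥ 2` at `𝔮` (the Galois rings `GR(2^c, 4)`) are not transcribed.  Nothing
here says anything about the status of the Hodge conjecture for CM abelian varieties, which is NOT proved.
-/

set_option autoImplicit false

noncomputable section

namespace Summit.Ventures.HodgeRepro.PeriodCloser

namespace InertModel

/-- **`ε(½, ω, ψ̃) = ±1` at `𝔮 | 2`, conductor `1`, on `𝔽₁₆`**: gen 3's `sign_q` with `|𝔽₁₆| = 16`, the
primitive `ψ̃ = ψ₀ ∘ Tr`, and `ConjDual` from `conjDual_inert` (`ψ̃ ∘ σ = ψ̃ ∘ (−1 ·)` is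
`psiTilde_conj_neg`); the hypotheses left are intrinsic to `ω`. -/
theorem eps_sign_inert (ψ₀ : AddChar (ZMod 2) ℂ) (h₀ : ψ₀ 1 ≠ 1) (κ : ℂ) (hκ : κ ^ 2 * 16 = 1) (n : ℕ)
    (ω : LocalChar F16) (hω : ω.unit ≠ 1) (hπ : ω.piVal ≠ 0) (hσω : ∀ x, ω.unit (conj x) = ω.unit⁻¹ x)
    (hπ2 : ω.piVal ^ 2 = 1) :
    LocalChar.eps κ n ω (psiTilde ψ₀) = 1 ∨ LocalChar.eps κ n ω (psiTilde ψ₀) = -1 :=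
  sign_q card_galoisField_two_four κ n ω (psiTilde ψ₀) hω (psiTilde_isPrimitive ψ₀ h₀) hπ hκ
    (LocalChar.conjDual_inert κ n ω (psiTilde ψ₀) conj (psiTilde_conj_neg ψ₀) hσω hπ2)

/-- The same with `ψ₀ = (−1)^x` and `κ = ¼`. -/
theorem eps_sign_inert_quarter (n : ℕ) (ω : LocalChar F16) (hω : ω.unit ≠ 1) (hπ : ω.piVal ≠ 0)
    (hσω : ∀ x, ω.unit (conj x) = ω.unit⁻¹ x) (hπ2 : ω.piVal ^ 2 = 1) :
    LocalChar.eps (1 / 4) n ω (psiTilde psi0) = 1 ∨ LocalChar.eps (1 / 4) n ω (psiTilde psi0) = -1 :=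
  eps_sign_inert psi0 psi0_one_ne_one (1 / 4) (by norm_num) n ω hω hπ hσω hπ2

end InertModel

end Summit.Ventures.HodgeRepro.PeriodCloser

end
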